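import Literature.AlgebraicGeometry.Motives.MixedHodgeStructureInternalHomFiltrations
import Literature.AlgebraicGeometry.HodgeTheory.SecondaryPeriodOfPair
import HarnessLib

/-!
# Carlson's Jacobian `J⁰Hom(A, B)` is the rational `0`-th Jacobian of the internal Hom `Hom(A, B)`

J. A. Carlson, *Extensions of mixed Hodge structures* (1980), §2(b): for a mixed Hodge structure `H`,
`J^p H = H_ℂ / (F^p H + H_ℤ)`, and (Prop. 2) for separated `A`, `B` the class of an extension
identifies `Ext(B, A)` with `J⁰Hom(B, A)`, where `Hom(B, A)` is the INTERNAL Hom mixed Hodge structure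
(§2(a)). The tree's `MixedHodgeStructure.JHom A B = Hom_ℂ(A_ℂ, B_ℂ) / (F⁰Hom_ℂ + Hom_ℚ(A, B))`
(`Motives/MixedHodgeExtension`, the target of `Extension.cls`) was built directly on `Hom_ℂ` with
Carlson's `F⁰Hom_ℂ = {φ | φ(F^p) ⊆ F^p}` (`homF`), before the internal Hom MHS `MixedHodgeStructure.hom`
existed; the tree's rational `p`-th Jacobian of an MHS is `MixedHodgeStructure.jacobianRat H p =
H_ℂ / (F^p H_ℂ + H_ℚ)` (`HodgeTheory/SecondaryPeriodOfPair`). With the identification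
`F^p Hom(A, B)_ℂ ↦ homF A B p` under `homBaseChange : ℂ ⊗ Hom_ℚ(A, B) ≅ Hom_ℂ(A_ℂ, B_ℂ)`
(`map_homBaseChange_hom_F`, `Motives/MixedHodgeStructureInternalHomFiltrations`) this file proves that the two
agree:

* `map_homBaseChange_jacobianSub` — `homBaseChange` carries `F⁰Hom(A, B)_ℂ + Hom(A, B)_ℚ ⊗ 1`
  (`(hom A B).jacobianSub 0`) onto `F⁰Hom_ℂ + Hom_ℚ` (`JHomSub A B`);
* **`jacobianRatHomEquivJHom A B : (hom A B).jacobianRat 0 ≃ₗ[ℚ] JHom A B`** — `J⁰(Hom(A, B))_ℚ ≅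
  J⁰Hom(A, B)`, `[ξ] ↦ [homBaseChange ξ]`; hence Carlson's extension class is a point of the `0`-th
  Jacobian of the internal Hom, `Extension.clsJacobian`, vanishing iff the (separated) extension
  splits (`Extension.isSplit_iff_clsJacobian_eq_zero`).

Definitions with bodies (a linear equivalence, the transported class) and theorems; no named fact.

## References

* [Carlson1980] J. A. Carlson, Extensions of mixed Hodge structures, Journées de géométrie
  algébrique d'Angers 1979 (1980), §2(a)–(b), Prop. 2.
* [CattaniElZeinGriffithsLe2014] E. Cattani et al. (eds.), Hodge Theory (2014), Thm. 8.4.2 and Remark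
  p. 380, §3.2.2.7 (2).
-/

noncomputable section

open scoped TensorProduct

namespace Literature.AlgebraicGeometry.Motives

namespace MixedHodgeStructure

universe u v w

variable {V : Type u} [AddCommGroup V] [Module ℚ V]
variable {V' : Type v} [AddCommGroup V'] [Module ℚ V']

open Module
open HodgeStructure (ofRat ofRat_apply homBaseChange homBaseChange_tmul homBaseChange_bijective)

/-! ### `homBaseChange` matches the two Jacobian denominators -/

/-- `homBaseChange : ℂ ⊗ Hom_ℚ(V, V') ≅ Hom_ℂ(V_ℂ, V'_ℂ)` as a `ℚ`-linear equivalence (bijective for `V`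
finite-dimensional, `homBaseChange_bijective`). [folklore] -/
def homBaseChangeEquiv [FiniteDimensional ℚ V] :
    (ℂ ⊗[ℚ] (V →ₗ[ℚ] V')) ≃ₗ[ℚ] (ℂ ⊗[ℚ] V →ₗ[ℂ] ℂ ⊗[ℚ] V') :=
  LinearEquiv.ofBijective ((homBaseChange V V').restrictScalars ℚ) (homBaseChange_bijective (V := V))

/-- The rational points `Hom_ℚ ⊗ 1` go to the complexified rational maps `Hom_ℚ ⊗ 1 ⊆ Hom_ℂ`
(`homBaseChange (1 ⊗ g) = g_ℂ`). [cite: Carlson1980, §2(a)–(b)] -/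
theorem map_homBaseChange_ratPoints :
    (ratPoints (V →ₗ[ℚ] V')).map ((homBaseChange V V').restrictScalars ℚ) = ratHom V V' := by
  apply le_antisymm
  · rintro _ ⟨_, ⟨g, rfl⟩, rfl⟩
    refine ⟨g, ?_⟩
    rw [LinearMap.baseChangeHom_apply, LinearMap.restrictScalars_apply, ofRat_apply, homBaseChange_tmul, one_smul]
  · rintro _ ⟨g, rfl⟩
    refine ⟨ofRat g, ofRat_mem_ratPoints g, ?_⟩
    rw [LinearMap.baseChangeHom_apply, LinearMap.restrictScalars_apply, ofRat_apply, homBaseChange_tmul, one_smul]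

variable [FiniteDimensional ℚ V] [FiniteDimensional ℚ V'] (A : MixedHodgeStructure V)
  (B : MixedHodgeStructure V')

/-- **`homBaseChange` carries `F⁰Hom(A, B)_ℂ + Hom(A, B)_ℚ` onto `F⁰Hom_ℂ + Hom_ℚ`** — the denominators of
the rational `0`-th Jacobian of the internal Hom (`jacobianSub (hom A B) 0`) and of Carlson's
`J⁰Hom(A, B)` (`JHomSub A B`) correspond (`map_homBaseChange_hom_F`: `F⁰ Hom(A, B)_ℂ ↦ homF A B 0`).
[cite: Carlson1980, §2(b)] -/
theorem map_homBaseChange_jacobianSub :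
    ((hom A B).jacobianSub 0).map ((homBaseChange V V').restrictScalars ℚ) = JHomSub A B := by
  rw [jacobianSub, JHomSub, Submodule.map_sup, map_homBaseChange_ratPoints]
  congr 1
  ext φ
  simp only [Submodule.mem_map, Submodule.restrictScalars_mem, LinearMap.restrictScalars_apply]
  rw [← map_homBaseChange_hom_F, Submodule.mem_map]

/-! ### `J⁰(Hom(A, B))_ℚ ≅ J⁰Hom(A, B)` -/

/-- **Carlson's Jacobian is the `0`-th Jacobian of the internal Hom**:
`J⁰(Hom(A, B))_ℚ = Hom(A, B)_ℂ / (F⁰ + Hom(A, B)_ℚ) ≃ Hom_ℂ(A_ℂ, B_ℂ) / (F⁰Hom_ℂ + Hom_ℚ) = J⁰Hom(A, B)`,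
induced by `homBaseChange` (Carlson 1980, §2(b): "`J^p H = H_ℂ / (F^p H + H_ℤ)`" applied to the mixed
Hodge structure `H = Hom` of §2(a); Cattani et al., Thm. 8.4.2: the class lives in `J(L) = L_ℂ/(F⁰L_ℂ + L_ℤ)`
for `L = Hom`). [cite: Carlson1980, §2(b) and Prop. 2] [cite: CattaniElZeinGriffithsLe2014, Thm. 8.4.2] -/
def jacobianRatHomEquivJHom : (hom A B).jacobianRat 0 ≃ₗ[ℚ] JHom A B :=
  Submodule.Quotient.equiv _ _ (homBaseChangeEquiv (V := V) (V' := V')) (map_homBaseChange_jacobianSub A B)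

/-- On classes: `[ξ] ↦ [homBaseChange ξ]`. [cite: Carlson1980, §2(b)] -/
@[simp]
theorem jacobianRatHomEquivJHom_mk (ξ : ℂ ⊗[ℚ] (V →ₗ[ℚ] V')) :
    jacobianRatHomEquivJHom A B ((hom A B).toJacobianRat 0 ξ) = JHom.mk A B (homBaseChange V V' ξ) :=
  rfl

/-- On classes, backwards: `[φ] ↦ [homBaseChange⁻¹ φ]`; in particular `[g_ℂ] ↦ [1 ⊗ g] = 0` for a rational
map `g`. [cite: Carlson1980, §2(b)] -/
theorem jacobianRatHomEquivJHom_symm_mk_baseChange (g : V →ₗ[ℚ] V') :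
    (jacobianRatHomEquivJHom A B).symm (JHom.mk A B (g.baseChange ℂ)) = 0 := by
  rw [LinearEquiv.symm_apply_eq, map_zero]
  exact (JHom.mk_eq_zero_iff _).2 (Submodule.mem_sup_right (baseChange_mem_ratHom g))

/-! ### The extension class as a point of `J⁰(Hom(A, B))_ℚ` -/

namespace Extension

variable {VE : Type w} [AddCommGroup VE] [Module ℚ VE] {A B}

/-- **The class of an extension `0 → B → E → A → 0` of MHS in the `0`-th Jacobian of the internal Hom**
`J⁰(Hom(A, B))_ℚ`: Carlson's class `E.cls ∈ J⁰Hom(A, B)` transported along `jacobianRatHomEquivJHom`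
(Carlson 1980, Prop. 2; Cattani et al., Thm. 8.4.2). [cite: Carlson1980, Prop. 2]
[cite: CattaniElZeinGriffithsLe2014, Thm. 8.4.2] -/
def clsJacobian (E : Extension A B VE) : (hom A B).jacobianRat 0 :=
  (jacobianRatHomEquivJHom A B).symm E.cls

/-- `clsJacobian` maps to Carlson's class. [cite: Carlson1980, Prop. 2] -/
@[simp]
theorem jacobianRatHomEquivJHom_clsJacobian (E : Extension A B VE) :
    jacobianRatHomEquivJHom A B E.clsJacobian = E.cls :=
  (jacobianRatHomEquivJHom A B).apply_symm_apply E.cls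

/-- A split extension has class `0` in `J⁰(Hom(A, B))_ℚ`. [cite: Carlson1980, Prop. 2] -/
theorem clsJacobian_eq_zero_of_isSplit (E : Extension A B VE) (h : E.IsSplit) : E.clsJacobian = 0 := by
  rw [clsJacobian, E.cls_eq_zero_of_isSplit h, map_zero]

/-- **Carlson, Prop. 2 (the zero class), in the `0`-th Jacobian of the internal Hom**: a SEPARATED
extension of mixed Hodge structures splits iff its class in `J⁰(Hom(A, B))_ℚ` vanishes.
[cite: Carlson1980, Prop. 2] -/
theorem isSplit_iff_clsJacobian_eq_zero (E : Extension A B VE) (hsep : IsSeparated A B) :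
    E.IsSplit ↔ E.clsJacobian = 0 := by
  rw [E.isSplit_iff_cls_eq_zero hsep, clsJacobian, LinearEquiv.symm_apply_eq, map_zero, eq_comm]

end Extension

end MixedHodgeStructure

end Literature.AlgebraicGeometry.Motives

end
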